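import Summits.BirchSwinnertonDyer.BirchSwinnertonDyer.Theorems.GenusKolyvaginAtTwoPowDvdShaCardAtTwoRTRelaxedCount
import Literature.NumberTheory.EllipticCurves.DivisionPolynomialTorsion
import HarnessLib

/-!
# Route `GenusKolyvaginAtTwo`, crux L_T `PowDvdShaCardAtTwoRT` (stmt-BirchSwinnertonDyer-23242), LINE 18 stub L, bottom rung:
# THE DEEP-OWN-PRIME TERM OF THE `X = 2Z` RECIPROCITY — `2·b(M, M) = 0` for `M = L ⊔ V[2]`, `L` isotropic

LEAD seat `bsd-line-gk2-p1` g16 (cell `bsd-f1-sign2`), `--supports 23242 --as helper`.  Pure algebra; THEOREMS ONLY; no `sorry`.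
BSD is NOT proved by any of this; neither is the crux nor stub L.

WHY (memo `Cruxes/PowDvdShaCardAtTwoRT/Lines/plus-descent-lead-g16.md` §8–§9).  In the level-4 bottom-rung engine the class
`Z = desc c₂(nℓ′) ∈ H¹(ℚ, E^ε[4])` is paired, DOUBLED (`X = 2Z`), against the auxiliary `y`.  At a deep own prime `ℓ ∣ n` both local
components lie in `M_ℓ := H¹_tr(ℚ_ℓ) ⊔ H¹(ℚ_ℓ, E^ε[4])[2]` (`y` by the choice of its Selmer structure; `Z` because the Frobenius value of a
Kolyvagin class at an own prime lies in the conorm line, gk2-p3 `…KolyvaginValuesLine` + LEAD g15 `…EigenNorms`, so its unramified part is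
killed by `2`), and the transverse line is ISOTROPIC (I7, gk2-p3 p689464/p693866).  This file is the one-line algebra that makes the term
vanish: for ANY biadditive `b` and ANY isotropic `L`, `2·b(z, y) = 0` for `z, y ∈ L ⊔ V[2]` — no Hilbert symbol, no eigen bookkeeping for
`y`, no cyclicity; plus the size bookkeeping `#(L ⊔ V[2])·#(L ⊓ V[2]) = #L·#V[2]` (so `#M_ℓ = 4·4/2 = 8` and `8² = #H¹₂·#H¹₄ = 64`: deep own
primes are neutral in `exists_mem_solutions_nsmul_ne_zero_canonical`'s numerical hypothesis).
WHAT (namespace `…Theorems.GenusExact.RelaxedCount`): `two_nsmul_pairing_eq_zero_of_mem_sup_torsionBy`,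
`pairing_two_nsmul_eq_zero_of_mem_sup_torsionBy`, `natCard_sup_torsionBy_mul`, `natCard_mul_le_mul_natCard_sup_torsionBy`.  Closes nothing.

References: [McCallumLMS1991] §5 Lemma 5.3 and proof of Prop. 5.2; [MazurRubin2004] Prop. 1.3.2 (ii).
-/

set_option autoImplicit false
-- `Summit.<P>.<Sub>` repeats `BirchSwinnertonDyer` by the tree's layout convention (D-0017)
set_option linter.dupNamespace false

namespace Summit.BirchSwinnertonDyer.BirchSwinnertonDyer.Theorems.GenusExact.RelaxedCount

open Function AddSubgroup

/-! ## `M = L ⊔ V[2]` for an isotropic `L` -/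

/-!

At a deep own prime the auxiliary `y` and the class `Z = desc c₂(nℓ′)` both lie in `M_ℓ := H¹_tr ⊔ H¹(ℚ_ℓ, E^ε[4])[2]` (for `Z`: its
unramified part is killed by `2`, gk2-p3's eigen-line reading), and the engine pairs `X = 2Z` with `y`: the term vanishes for EVERY pair in
`M_ℓ` by bilinearity alone, given only that `H¹_tr` is isotropic (I7). -/

section DoubleKill

variable {V : Type*} [AddCommGroup V] {R : Type*} [AddCommGroup R]

/-- **`2·b(z, y) = 0` on `L ⊔ V[2]` for an isotropic `L`.**  `b` biadditive, `L ≤ V` with `b(l, l′) = 0` on `L`; if `z, y ∈ L ⊔ V[2]`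
(`V[2]` the `2`-torsion) then `2 • b z y = 0`: writing `z = l₁ + f₁`, `y = l₂ + f₂` with `2fᵢ = 0`,
`2 b(z,y) = 2 b(l₁,l₂) + b(l₁, 2f₂) + b(2f₁, y) = 0`.  (The deep-own-prime term `⟨2Z, y⟩` of the bottom-rung reciprocity.) [folklore] -/
theorem two_nsmul_pairing_eq_zero_of_mem_sup_torsionBy (b : V →+ V →+ R) (L : AddSubgroup V)
    (hL : ∀ l ∈ L, ∀ l' ∈ L, b l l' = 0) {z y : V}
    (hz : z ∈ L ⊔ AddSubgroup.torsionBy V 2) (hy : y ∈ L ⊔ AddSubgroup.torsionBy V 2) :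
    2 • b z y = 0 := by
  obtain ⟨l₁, hl₁, f₁, hf₁, rfl⟩ := AddSubgroup.mem_sup.mp hz
  obtain ⟨l₂, hl₂, f₂, hf₂, rfl⟩ := AddSubgroup.mem_sup.mp hy
  have hf₁' : (2 : ℕ) • f₁ = 0 := by
    have h := (Literature.NumberTheory.EllipticCurves.mem_torsionBy_iff (a := f₁)).mp hf₁
    rw [← natCast_zsmul]
    exact_mod_cast h
  have hf₂' : (2 : ℕ) • f₂ = 0 := by
    have h := (Literature.NumberTheory.EllipticCurves.mem_torsionBy_iff (a := f₂)).mp hf₂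
    rw [← natCast_zsmul]
    exact_mod_cast h
  have h2z : (2 : ℕ) • (l₁ + f₁) = (2 : ℕ) • l₁ := by rw [smul_add, hf₁', add_zero]
  calc 2 • b (l₁ + f₁) (l₂ + f₂) = b ((2 : ℕ) • (l₁ + f₁)) (l₂ + f₂) := by rw [map_nsmul, AddMonoidHom.nsmul_apply]
    _ = b ((2 : ℕ) • l₁) (l₂ + f₂) := by rw [h2z]
    _ = (2 : ℕ) • b l₁ (l₂ + f₂) := by rw [map_nsmul, AddMonoidHom.nsmul_apply]
    _ = (2 : ℕ) • (b l₁ l₂ + b l₁ f₂) := by rw [map_add]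
    _ = (2 : ℕ) • b l₁ f₂ := by rw [hL l₁ hl₁ l₂ hl₂, zero_add]
    _ = b l₁ ((2 : ℕ) • f₂) := by rw [map_nsmul]
    _ = 0 := by rw [hf₂', map_zero]

/-- **The pairing of a DOUBLED class with `L ⊔ V[2]` vanishes**: `b (2•z) y = 0` for `z, y ∈ L ⊔ V[2]` — the form in which the engine
uses it (`X = 2Z`). [folklore] -/
theorem pairing_two_nsmul_eq_zero_of_mem_sup_torsionBy (b : V →+ V →+ R) (L : AddSubgroup V)
    (hL : ∀ l ∈ L, ∀ l' ∈ L, b l l' = 0) {z y : V}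
    (hz : z ∈ L ⊔ AddSubgroup.torsionBy V 2) (hy : y ∈ L ⊔ AddSubgroup.torsionBy V 2) :
    b ((2 : ℕ) • z) y = 0 := by
  rw [map_nsmul, AddMonoidHom.nsmul_apply]
  exact two_nsmul_pairing_eq_zero_of_mem_sup_torsionBy b L hL hz hy

/-- **Size of `L ⊔ V[2]`**: `#(L ⊔ V[2]) · #(L ⊓ V[2]) = #L · #V[2]`; so with `L ≅ ℤ/4` (`#L = 4`, `#L[2] = 2`) and `#V[2] = 4` the
condition has order `8` (memo §9: `8² = 64 = #H¹(ℚ_ℓ,E^ε[2]) · #H¹(ℚ_ℓ,E^ε[4])`, so deep own primes are neutral in the two-level count).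
[folklore] -/
theorem natCard_sup_torsionBy_mul [Finite V] (L : AddSubgroup V) :
    Nat.card ↥(L ⊔ AddSubgroup.torsionBy V 2) * Nat.card ↥(L ⊓ AddSubgroup.torsionBy V 2) =
      Nat.card L * Nat.card ↥(AddSubgroup.torsionBy V 2) :=
  natCard_sup_mul_natCard_inf L (AddSubgroup.torsionBy V 2)

/-- **Lower bound**: `#V[2] · #L ≤ #(L ⊔ V[2]) · #L[2]`-free form — if `#(L ⊓ V[2]) ≤ c` then `#L · #V[2] ≤ c · #(L ⊔ V[2])`. [folklore] -/
theorem natCard_mul_le_mul_natCard_sup_torsionBy [Finite V] (L : AddSubgroup V) {c : ℕ}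
    (hc : Nat.card ↥(L ⊓ AddSubgroup.torsionBy V 2) ≤ c) :
    Nat.card L * Nat.card ↥(AddSubgroup.torsionBy V 2) ≤ c * Nat.card ↥(L ⊔ AddSubgroup.torsionBy V 2) := by
  rw [← natCard_sup_torsionBy_mul L, mul_comm]
  exact Nat.mul_le_mul_right _ hc

end DoubleKill

/-! ## The `ℓ′`-term does NOT vanish (appendix, g16): a class of order 4 meeting the Lagrangian `F` trivially pairs non-trivially,
after doubling, with a generator of `F` -/

section NonVanishing

variable {V : Type*} [AddCommGroup V] {n : ℕ}

/-- **`b(2•z, y) ≠ 0`** when `{}^⊥F ≤ F` (Lagrangian/coisotropic), every `f ∈ F` is a multiple of `y`, the cyclic group `⟨z⟩`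
meets `F` trivially, and `2•z ≠ 0`: otherwise `2•z ⊥ F`, so `2•z ∈ {}^⊥F = F`, so `2•z ∈ ⟨z⟩ ∩ F = 0`.  In the bottom-rung engine:
`V = H¹(ℚ_{ℓ′}, E^ε[4])`, `F = H¹_f` (Lagrangian, cyclic), `z = loc_{ℓ′} desc c₂(nℓ′)` (order 4, `⟨z⟩ ∩ H¹_f = 0` by Q2 since `P_n ∉ 2E(K_{λ′})`),
`y = loc_{ℓ′}` of the auxiliary (a generator of `H¹_f` by the full-order pair Čebotarev) — so the `ℓ′`-term of the `X = 2Z` reciprocity is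
non-zero, contradicting `invWeilPairing_eq_zero_of_bottomRung`. [cite: McCallumLMS1991, §5 Lemma 5.3 and proof of Prop. 5.2] -/
theorem pairing_two_nsmul_ne_zero_of_lagrangian (b : V →+ V →+ ZMod n) (F : AddSubgroup V)
    (hF : Summit.BirchSwinnertonDyer.Rank1Residual.X11b.FiniteDuality.annLeft b F ≤ F)
    {z y : V} (hgen : ∀ f ∈ F, ∃ k : ℤ, f = k • y)
    (hmeet : ∀ k : ℤ, k • z ∈ F → k • z = 0) (hz : (2 : ℤ) • z ≠ 0) :
    b ((2 : ℕ) • z) y ≠ 0 := by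
  intro h0
  -- `2•z ⊥ F`
  have hperp : (2 : ℕ) • z ∈ Summit.BirchSwinnertonDyer.Rank1Residual.X11b.FiniteDuality.annLeft b F := by
    rw [Summit.BirchSwinnertonDyer.Rank1Residual.X11b.FiniteDuality.mem_annLeft_iff]
    intro f hf
    obtain ⟨k, rfl⟩ := hgen f hf
    rw [map_zsmul, h0, smul_zero]
  have hmem : (2 : ℤ) • z ∈ F := by
    have h := hF hperp
    rwa [← natCast_zsmul] at h
  exact hz (hmeet 2 hmem)

end NonVanishing

end Summit.BirchSwinnertonDyer.BirchSwinnertonDyer.Theorems.GenusExact.RelaxedCount
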